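import Summits.CriticalPhenomena.CardyFormulaZ2.Theorems.CardySusyWardWeakHolomorphySmoothMode
import Summits.CriticalPhenomena.CardyFormulaZ2.Theorems.CardySusyWardWeakHolomorphyAliasHalfCR

/-!
# The sublattice-staggered four-dart mode of the spin-`1/3` dart observable is free

Line `Sketch` of the crux `CardySusyWard.WeakHolomorphy` (stmt-CriticalPhenomena-11292), skeleton v10 (lead c5,
`--supports`).  The crux is the weak Kirchhoff law `δ^{5/3} Σ_p ∂φ(z_p)·K^s_p → 0` with
`K^s_p = F(c₁)+F(c₃)−F(c₀)−F(c₂)` (`weakHolomorphy_iff_weakKirchhoff`), and v10 splits `K^s = 2·s·in − s·(in+out)`.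
Here the h/v-STAGGERED four-dart sum `s_p·(F(c₀)+F(c₁)+F(c₂)+F(c₃))` (`F = bondDartObservable (Λ δ) δ (1/3)`, `s_p = ±1`
the horizontal/vertical sublattice sign) is shown to pair to `o(δ^{-5/3})` with EVERY smooth compactly supported weight
along every eventually `ℤ²`-admissible mesh family (`stub_staggeredFourDartFree`).  Two moves over landed files:
(1) the alias corner identity `alias_corner_eq`: `F^{(−5/3)}(c_{p,k}) = (−1)^{k+c₀.2} F^{(1/3)}(c_{p,k})`, whence
`Σ_k F^{(1/3)}(c_{p,k}) = −(−1)^{c₀.2}·(F^{(−5/3)}(c₁)+F^{(−5/3)}(c₃)−F^{(−5/3)}(c₀)−F^{(−5/3)}(c₂))`, the signed Kirchhoff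
combination of the spin-`−5/3` alias up to a global unit sign; (2) `s_p·K^{s,(σ)}_p` is the plain divergence `in − out` of the
spin-`σ` dart observable, whose smooth pairing telescopes along twins to dart differences of `ψ` (`≤ ‖∇ψ‖_∞ δ` each, over
`O(δ⁻²)` darts): `O(δ^{2/3})` at EVERY spin (`smoothDivergence_tendsto_zero_spin`, the spin-generic copy of
`smoothDivergence_tendsto_zero`).  References: Duminil-Copin–Smirnov arXiv:1109.1549 §8.3; Duminil-Copin arXiv:1208.3787
Prop. 4; crux workfiles `Cruxes/WeakHolomorphy/{STRATEGY-CENSUS.md §1, Lines/Sketch.md}`.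
-/

noncomputable section

namespace Summit.CriticalPhenomena.CardyFormulaZ2.Theorems.WeakHolomorphy.SplitBypass

open scoped BigOperators Topology
open Filter Set MeasureTheory Complex
open _root_.Literature.Probability.LatticeModels
open _root_.Literature.Barriers.CriticalPhenomena (medialCornersAt medialVertexOf)
open _root_.Literature.Barriers.CriticalPhenomena.HalfCRGreen (twin twin_snd)
open _root_.Literature.Probability.LatticeModels.DiscreteDobrushin (startCorner)

/-- **The unstaggered (smooth) mode of the Kirchhoff defect is `O(δ^{2/3})` at EVERY spin `σ`.** With
`K^s_p = F(NE)+F(SW)−F(NW)−F(SE)` for `F = bondDartObservable (Λ δ) δ σ` and the sublattice sign `s_p`,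
`δ^{5/3} Σ_p ψ(z_p)·s_p·K^s_p → 0` as `δ → 0⁺`, for every mesh family and every smooth compactly supported `ψ`
(twin regrouping: the pairing telescopes to dart differences of `ψ`, each `≤ ‖∇ψ‖_∞ δ`, over `O(δ⁻²)` darts, and
`‖F‖ ≤ 1` at every spin).  Spin-generic copy of `smoothDivergence_tendsto_zero`. [folklore] -/
theorem smoothDivergence_tendsto_zero_spin (Λ : ℝ → DiscreteDobrushin) (σ : ℝ) (ψ : ℂ → ℂ)
    (hψ : ContDiff ℝ (⊤ : ℕ∞) ψ) (hc : HasCompactSupport ψ) :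
    Tendsto (fun δ : ℝ => ((δ ^ ((5:ℝ) / 3) : ℝ) : ℂ) * ∑ᶠ p : Site 2 × Fin 2,
        ψ (medialPoint δ (medialVertexOf p)) * ((if p.2 = 0 then (1 : ℂ) else -1) *
          (bondDartObservable (Λ δ) δ σ (medialCornersAt p.1 p.2 1) +
            bondDartObservable (Λ δ) δ σ (medialCornersAt p.1 p.2 3) -
            bondDartObservable (Λ δ) δ σ (medialCornersAt p.1 p.2 0) -
            bondDartObservable (Λ δ) δ σ (medialCornersAt p.1 p.2 2))))
      (𝓝[>] 0) (𝓝 0) := by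
  classical
  set K := tsupport ψ with hKdef
  have hK : IsCompact K := hc.isCompact
  have hKψ : ∀ z ∉ K, ψ z = 0 := fun z hz => image_eq_zero_of_notMem_tsupport hz
  obtain ⟨B, hB⟩ := (hψ.continuous_fderiv (by simp)).bounded_above_of_compact_support (hc.fderiv (𝕜 := ℝ))
  have hB0 : 0 ≤ B := (norm_nonneg _).trans (hB 0)
  have hdiff : ∀ z, DifferentiableAt ℝ ψ z := fun z => (hψ.differentiable (by simp)).differentiableAt
  have hLip : ∀ x y : ℂ, ‖ψ y - ψ x‖ ≤ B * ‖y - x‖ := fun x y =>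
    Convex.norm_image_sub_le_of_norm_fderiv_le (fun z _ => hdiff z) (fun z _ => hB z) convex_univ (mem_univ x) (mem_univ y)
  obtain ⟨CN, hCN⟩ := stub_count K hK
  have hFd : ∀ δ c, ‖bondDartObservable (Λ δ) δ σ c‖ ≤ 1 := fun δ c => Parafermion.norm_bondDartObservable_le_one _ _ _ _
  -- ### the bound at one mesh
  have hbound : ∀ᶠ δ in 𝓝[>] (0:ℝ), ‖((δ ^ ((5:ℝ) / 3) : ℝ) : ℂ) * ∑ᶠ p : Site 2 × Fin 2,
      ψ (medialPoint δ (medialVertexOf p)) * ((if p.2 = 0 then (1 : ℂ) else -1) *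
        (bondDartObservable (Λ δ) δ σ (medialCornersAt p.1 p.2 1) +
          bondDartObservable (Λ δ) δ σ (medialCornersAt p.1 p.2 3) -
          bondDartObservable (Λ δ) δ σ (medialCornersAt p.1 p.2 0) -
          bondDartObservable (Λ δ) δ σ (medialCornersAt p.1 p.2 2)))‖ ≤ 2 * B * |CN| * δ ^ ((2:ℝ) / 3) := by
    have E4 : ∀ᶠ δ in 𝓝[>] (0:ℝ), δ ∈ Set.Ioo (0:ℝ) 1 := Ioo_mem_nhdsGT one_pos
    filter_upwards [E4] with δ hδ
    have hδ0 : 0 < δ := hδ.1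
    have hδ1 : δ ≤ 1 := hδ.2.le
    obtain ⟨S, hS, hcard⟩ := hCN δ hδ0 hδ1
    set zp : Site 2 × Fin 2 → ℂ := fun p => medialPoint δ (medialVertexOf p) with hzp
    set Fd : Site 2 × Site 2 → ℂ := fun c => bondDartObservable (Λ δ) δ σ c with hFd_def
    set sg : Site 2 × Fin 2 → ℂ := fun p => if p.2 = 0 then (1 : ℂ) else -1 with hsg
    set w : Site 2 × Fin 2 → Fin 4 → ℂ := fun p k => ψ (zp p) * sg p * (-1) ^ (k.val + 1) with hw
    -- the summand at `p` is `Σ_k w(p,k) Fd(c_{p,k})`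
    have hsumk : ∀ p, ∑ k : Fin 4, w p k * Fd (medialCornersAt p.1 p.2 k) =
        ψ (zp p) * (sg p * (Fd (medialCornersAt p.1 p.2 1) + Fd (medialCornersAt p.1 p.2 3) -
          Fd (medialCornersAt p.1 p.2 0) - Fd (medialCornersAt p.1 p.2 2))) := by
      intro p
      simp only [hw, Fin.sum_univ_four, Fin.isValue, Fin.val_zero, Fin.val_one, Fin.val_two,
        show (3 : Fin 4).val = 3 from rfl]
      ring
    have hsupp : ∀ (p : Site 2 × Fin 2) (k : Fin 4), w p k ≠ 0 → p ∈ S ∧ twin p.1 p.2 k ∈ S := by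
      intro p k hne
      have hzK : zp p ∈ K := by
        by_contra hz
        apply hne
        simp [hw, hKψ _ hz]
      refine ⟨hS p (Metric.self_subset_cthickening K hzK), hS _ ?_⟩
      refine Metric.mem_cthickening_of_dist_le _ (zp p) 1 K hzK ?_
      rw [dist_comm, dist_eq_norm]
      exact (norm_medialPoint_sub_twin_le hδ0.le p k).trans hδ1
    have hfin : ∑ᶠ p : Site 2 × Fin 2, ψ (zp p) * (sg p * (Fd (medialCornersAt p.1 p.2 1) +
        Fd (medialCornersAt p.1 p.2 3) - Fd (medialCornersAt p.1 p.2 0) - Fd (medialCornersAt p.1 p.2 2))) =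
        ∑ p ∈ S, ∑ k : Fin 4, w p k * Fd (medialCornersAt p.1 p.2 k) := by
      rw [finsum_eq_sum_of_support_subset _ (s := S) ?_]
      · exact Finset.sum_congr rfl fun p _ => (hsumk p).symm
      · intro p hp
        rw [Function.mem_support] at hp
        have hzK : zp p ∈ K := by
          by_contra hz
          exact hp (by rw [hKψ _ hz, zero_mul])
        exact hS p (Metric.self_subset_cthickening K hzK)
    -- symmetrised weights are `≤ B δ`
    have hR : ∀ p ∈ S, ∀ k : Fin 4, ‖w p k + w (twin p.1 p.2 k) (k + 2)‖ ≤ B * δ := by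
      intro p _ k
      have hsym : w p k + w (twin p.1 p.2 k) (k + 2) =
          (-1) ^ (k.val + 1) * sg p * (ψ (zp p) - ψ (zp (twin p.1 p.2 k))) := by
        simp only [hw, hsg]
        rw [taylorComb_neg_one_pow k, stagger_twin p k]
        ring
      rw [hsym, norm_mul, norm_mul, taylorComb_norm_sign, one_mul]
      have hs1 : ‖sg p‖ = 1 := by simp only [hsg]; split_ifs <;> simp
      rw [hs1, one_mul]
      exact (hLip _ _).trans (mul_le_mul_of_nonneg_left (norm_medialPoint_sub_twin_le hδ0.le p k) hB0)
    have hmaster : ‖∑ p ∈ S, ∑ k : Fin 4, w p k * Fd (medialCornersAt p.1 p.2 k)‖ ≤ 2 * (B * δ) * 1 * S.card :=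
      master_norm_bound stub_regroup S w Fd (by positivity) zero_le_one hsupp hR (fun p _ k => hFd δ _)
    have hcardabs : δ ^ 2 * (S.card : ℝ) ≤ |CN| := hcard.trans (le_abs_self _)
    rw [norm_mul, Complex.norm_real, Real.norm_of_nonneg (Real.rpow_nonneg hδ0.le _), hfin]
    have h53 : δ ^ ((5:ℝ) / 3) = δ ^ ((2:ℝ) / 3) * δ := by
      rw [show (5:ℝ) / 3 = (2:ℝ) / 3 + 1 by norm_num, Real.rpow_add hδ0, Real.rpow_one]
    have hδ2 : δ * δ * (S.card : ℝ) ≤ |CN| := by rw [← sq]; exact hcardabs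
    calc δ ^ ((5:ℝ) / 3) * ‖∑ p ∈ S, ∑ k : Fin 4, w p k * Fd (medialCornersAt p.1 p.2 k)‖
        ≤ δ ^ ((5:ℝ) / 3) * (2 * (B * δ) * 1 * S.card) := mul_le_mul_of_nonneg_left hmaster (Real.rpow_nonneg hδ0.le _)
      _ = 2 * B * δ ^ ((2:ℝ) / 3) * (δ * δ * S.card) := by rw [h53]; ring
      _ ≤ 2 * B * δ ^ ((2:ℝ) / 3) * |CN| := mul_le_mul_of_nonneg_left hδ2 (by positivity)
      _ = 2 * B * |CN| * δ ^ ((2:ℝ) / 3) := by ring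
  -- ### `δ^{2/3} → 0`
  have ht0 : Tendsto (fun δ : ℝ => 2 * B * |CN| * δ ^ ((2:ℝ) / 3)) (𝓝[>] (0:ℝ)) (𝓝 0) := by
    have hc' : Tendsto (fun δ : ℝ => δ ^ ((2:ℝ) / 3)) (𝓝 (0:ℝ)) (𝓝 ((0:ℝ) ^ ((2:ℝ) / 3))) :=
      (Real.continuousAt_rpow_const 0 ((2:ℝ) / 3) (Or.inr (by norm_num))).tendsto
    rw [Real.zero_rpow (by norm_num)] at hc'
    simpa using (hc'.mono_left nhdsWithin_le_nhds).const_mul (2 * B * |CN|)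
  exact squeeze_zero_norm' hbound ht0

/-- **The alias, summed over the four corners of a medial vertex**: for admissible data and `δ ≠ 0`, the plain four-dart sum of
the spin-`1/3` dart observable at `p` is, up to the global unit sign `−(−1)^{c₀.2}` (`c₀` the start corner), the SIGNED
Kirchhoff combination `F(c₁)+F(c₃)−F(c₀)−F(c₂)` of its spin-`−5/3` alias (`alias_corner_eq` corner by corner, the corner
parities alternating). [folklore] -/
theorem fourDart_third_eq_neg_sign_mul_kirchhoff_alias {E : DiscreteDobrushin} (hE : E.IsZdAdmissible)
    (p : Site 2 × Fin 2) {δ : ℝ} (hδ : δ ≠ 0) :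
    bondDartObservable E δ (1 / 3) (medialCornersAt p.1 p.2 0) + bondDartObservable E δ (1 / 3) (medialCornersAt p.1 p.2 1) +
        bondDartObservable E δ (1 / 3) (medialCornersAt p.1 p.2 2) + bondDartObservable E δ (1 / 3) (medialCornersAt p.1 p.2 3) =
      -(-1 : ℂ) ^ (startCorner hE).2.val *
        (bondDartObservable E δ (-5 / 3) (medialCornersAt p.1 p.2 1) + bondDartObservable E δ (-5 / 3) (medialCornersAt p.1 p.2 3) -
          bondDartObservable E δ (-5 / 3) (medialCornersAt p.1 p.2 0) - bondDartObservable E δ (-5 / 3) (medialCornersAt p.1 p.2 2)) := by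
  rw [alias_corner_eq hE p 0 hδ, alias_corner_eq hE p 1 hδ, alias_corner_eq hE p 2 hδ, alias_corner_eq hE p 3 hδ]
  have hu : (-1 : ℂ) ^ (startCorner hE).2.val * (-1 : ℂ) ^ (startCorner hE).2.val = 1 := by
    rw [← pow_add, ← two_mul, pow_mul, neg_one_sq, one_pow]
  simp only [pow_add, Fin.isValue, Fin.val_zero, Fin.val_one, Fin.val_two, show (3 : Fin 4).val = 3 from rfl]
  linear_combination (-(bondDartObservable E δ (1 / 3) (medialCornersAt p.1 p.2 0) +
    bondDartObservable E δ (1 / 3) (medialCornersAt p.1 p.2 1) + bondDartObservable E δ (1 / 3) (medialCornersAt p.1 p.2 2) +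
    bondDartObservable E δ (1 / 3) (medialCornersAt p.1 p.2 3))) * hu

/-- **`stub_staggeredFourDartFree` — the staggered four-dart (in + out) mode is free.** For every mesh family `Λ` that is
eventually `ℤ²`-admissible and every smooth compactly supported weight `ψ`,
`δ^{5/3} · Σ_p ψ(z_p) · s_p · (F(c_{p,0}) + F(c_{p,1}) + F(c_{p,2}) + F(c_{p,3})) → 0` as `δ → 0⁺`, where
`F = bondDartObservable (Λ δ) δ (1/3)`, `c_{p,k} = medialCornersAt p.1 p.2 k` and `s_p = +1 / −1` at horizontal / vertical medial
vertices.  (Alias corner identity ⟹ the summand is `∓ψ(z_p)·s_p·K^{s,(−5/3)}_p`, the unstaggered divergence of the spin-`−5/3`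
dart observable, which telescopes to dart differences of `ψ`: `O(δ^{2/3})` by `smoothDivergence_tendsto_zero_spin`.) [folklore] -/
theorem stub_staggeredFourDartFree : ∀ (Λ : ℝ → DiscreteDobrushin), (∀ᶠ δ in 𝓝[>] (0:ℝ), (Λ δ).IsZdAdmissible) →
    ∀ (ψ : ℂ → ℂ), ContDiff ℝ (⊤ : ℕ∞) ψ → HasCompactSupport ψ →
      Tendsto (fun δ : ℝ => ((δ ^ ((5:ℝ) / 3) : ℝ) : ℂ) * ∑ᶠ p : Site 2 × Fin 2,
          ψ (medialPoint δ (medialVertexOf p)) * ((if p.2 = 0 then (1 : ℂ) else -1) *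
            (bondDartObservable (Λ δ) δ (1 / 3) (medialCornersAt p.1 p.2 0) +
              bondDartObservable (Λ δ) δ (1 / 3) (medialCornersAt p.1 p.2 1) +
              bondDartObservable (Λ δ) δ (1 / 3) (medialCornersAt p.1 p.2 2) +
              bondDartObservable (Λ δ) δ (1 / 3) (medialCornersAt p.1 p.2 3))))
        (𝓝[>] 0) (𝓝 0) := by
  intro Λ hadm ψ hψ hc
  have h53 := smoothDivergence_tendsto_zero_spin Λ (-5 / 3) ψ hψ hc
  rw [tendsto_zero_iff_norm_tendsto_zero] at h53 ⊢
  refine h53.congr' ?_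
  filter_upwards [hadm, self_mem_nhdsWithin] with δ hE hδ
  have hδ0 : (0:ℝ) < δ := hδ
  -- the summands agree up to the global unit sign `−(−1)^{c₀.2}`
  have key : (fun p : Site 2 × Fin 2 => ψ (medialPoint δ (medialVertexOf p)) * ((if p.2 = 0 then (1 : ℂ) else -1) *
      (bondDartObservable (Λ δ) δ (1 / 3) (medialCornersAt p.1 p.2 0) +
        bondDartObservable (Λ δ) δ (1 / 3) (medialCornersAt p.1 p.2 1) +
        bondDartObservable (Λ δ) δ (1 / 3) (medialCornersAt p.1 p.2 2) +
        bondDartObservable (Λ δ) δ (1 / 3) (medialCornersAt p.1 p.2 3)))) =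
      fun p : Site 2 × Fin 2 => (-(-1 : ℂ) ^ (startCorner hE).2.val) *
        (ψ (medialPoint δ (medialVertexOf p)) * ((if p.2 = 0 then (1 : ℂ) else -1) *
          (bondDartObservable (Λ δ) δ (-5 / 3) (medialCornersAt p.1 p.2 1) +
            bondDartObservable (Λ δ) δ (-5 / 3) (medialCornersAt p.1 p.2 3) -
            bondDartObservable (Λ δ) δ (-5 / 3) (medialCornersAt p.1 p.2 0) -
            bondDartObservable (Λ δ) δ (-5 / 3) (medialCornersAt p.1 p.2 2)))) := by
    funext p
    rw [fourDart_third_eq_neg_sign_mul_kirchhoff_alias hE p hδ0.ne']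
    ring
  have hunit : ‖(-(-1 : ℂ) ^ (startCorner hE).2.val)‖ = 1 := by
    rw [norm_neg, norm_pow, norm_neg, norm_one, one_pow]
  rw [key, ← mul_finsum, norm_mul, norm_mul, norm_mul, hunit, one_mul]

end Summit.CriticalPhenomena.CardyFormulaZ2.Theorems.WeakHolomorphy.SplitBypass

end
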